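import Summits.QuantumFields.BalabanUV.Beta.FP.GradedIteratedDerivN
import Summits.QuantumFields.BalabanUV.Beta.FP.MaxwellSymbolDerivOn

/-!
# `BalabanUV.Beta.FP.MaxwellSymbolDerivN` — road «FP» for binder row D1, leaf H2-P, row H2-P-REG-N: `FP/MaxwellSymbolDeriv`∕`…On` RE-TYPED
# ORDER-PARAMETRIC — the weighted Maxwell ∕ Feynman entries along a coordinate slice are graded of order 4 ∕ 2 UP TO ANY ORDER `N`, when the weight's
# slices are `ContDiffOn ℝ N` on an open `U ∋ s i` with `w − 1` graded `(2, cw)` up to order `N` at `s i`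

HONEST DEPENDENCY (page 1, mandatory): continuum YM on T⁴ ⇐ BetaPertH ∧ nine spine estimates (0/9 proved); BetaPertH ⇐ (D1) ∧ (D4) ∧ CAP+tail;
G-an2-4 gates asym, D1 and NE2/3/4.  HONEST FRAMING (cell contract, verbatim): «discharging `BetaPertH` makes Bałaban's UV stability UNCONDITIONAL —
a real constructive-QFT result; it is NOT the continuum limit and NOT the Clay problem.»  THIS MODULE DISCHARGES NOTHING of the wall: [folklore] one-variable
calculus — the order-`N` toolkit `FP/GradedIteratedDerivN` applied to the slice identities of `FP/MaxwellSymbolDeriv` (p234904: `d1Sym_slice_eq`,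
`curlRow_slice_eq`, `excess_slice_eq`, `feyn_slice_eq`).  0 def; no `def … : Prop`; nothing cited; 0 sorry; NOT D1, NOT BetaPertH, NOT continuum, NOT Clay.

ABSOLUTE RULE (cell charter, verbatim): «No internally-minted statement may enter as a cited fact. Every hypothesis is either kernel-proved in this package or a
verbatim quotation of a PUBLISHED theorem with page reference. The manuscript(s) under audit are NOT citable for their own disputed steps — they are the thing
under adjudication; programme-internal (2001/route/tribunal) claims are never citable.»

CURRENCY.  `s : Fin d → ℝ`, direction `i`, slice `t ↦ Function.update s i t`; `U` OPEN, `s i ∈ U`; per `μ ν`: `hwC : ContDiffOn ℝ N (fun t => ((w μ ν (update s i t) : ℝ) : ℂ)) U`,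
`hw : ∀ n ≤ N, ‖iteratedDeriv n (fun t => ((w μ ν (update s i t) : ℝ) : ℂ) − 1) (s i)‖ ≤ cw·‖s‖^{2−n}` (`0 ≤ cw`); `‖s‖ ≤ M`, `1 ≤ M`.
WHAT.  §1 atoms∕curl rows∕plaquette factors to order `N` (`graded_plaq_sliceN`: `(2, 4·2^N·M²)`); §2 **`graded_excess_entry_onN`**:
`‖∂ᵢⁿ[maxwellMat (w−1)(d1Sym)]_{γβ}(s)‖ ≤ 2·4^N·d²·M⁶·cw·‖s‖^{4−n}` (`n ≤ N`); §3 **`graded_feyn_entry_onN`**: `≤ (2·4^N·d²·M⁴·(M²cw+1) + 2^N·M²)·‖s‖^{2−n}`;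
`contDiffOn_excess_entryN`∕`contDiffOn_feyn_entryN` (level `N` on `U`); §4 **`hasDerivAt_iteratedDeriv_slice_onN`** (chain, `j < N`, every `t ∈ U`).
At `N = 3`: `2·4³ = 128`, `2³ = 8` — the constants of the order-3 files.
Provenance: binder row G-an2-4 owner lineage gan24-p3, gen 16 (prover-b2b-balaban-gan24-p3-g16-0), 2026-08-20; row H2-P-REG-N (owner b2b-balaban-beta-d1-p3);
consumers H2-P-CHAIN-N (beta-d1-formalise-leaf-01), H2-P-INV-N (gan24-formalise-leaf-01, `FP/InverseSymbolDerivN` p237087), (K2)∕(K3) of H2-P-KER-ASM.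
-/

noncomputable section

namespace Summit.QuantumFields.BalabanUV.Beta.FP.MaxwellSymbolDerivN

open Complex Finset
open scoped BigOperators ComplexConjugate
open Literature.MathematicalPhysics.QuantumFieldTheory.Balaban1983to89
open B5Prop11Fiber (d1Sym)
open Summit.QuantumFields.BalabanUV.Beta.FP.PerfectPropagatorSymbol (curlRow maxwellMat feynMat)
open Summit.QuantumFields.BalabanUV.Beta.FP.GradedIteratedDeriv (contDiff_expSub contDiff_expNegSub)
open Summit.QuantumFields.BalabanUV.Beta.FP.GradedIteratedDerivN
open Summit.QuantumFields.BalabanUV.Beta.FP.MaxwellSymbolDeriv (d1Sym_slice_eq conj_d1Sym_slice_eq norm_d1Sym_le_norm curlRow_slice_eq conj_curlRow_slice_eq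
  norm_ite_le_one excess_slice_eq feyn_slice_eq)

variable {d : ℕ}

/-! ## §1 Atoms, curl rows, plaquette factors to order `N` -/

/-- [folklore] the atom slice is `ContDiff ℝ n` for every `n`. -/
theorem contDiff_d1Sym_sliceN {n : WithTop ℕ∞} (s : Fin d → ℝ) (i b : Fin d) : ContDiff ℝ n (fun t : ℝ => d1Sym (Function.update s i t) b) := by
  rw [d1Sym_slice_eq]
  split_ifs
  · exact contDiff_expSub
  · exact contDiff_const

/-- [folklore] the conjugate atom slice is `ContDiff ℝ n` for every `n`. -/
theorem contDiff_conj_d1Sym_sliceN {n : WithTop ℕ∞} (s : Fin d → ℝ) (i b : Fin d) :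
    ContDiff ℝ n (fun t : ℝ => conj (d1Sym (Function.update s i t) b)) := by
  rw [conj_d1Sym_slice_eq]
  split_ifs
  · exact contDiff_expNegSub
  · exact contDiff_const

/-- [folklore] **THE ATOM SLICE IS GRADED `(1, 1)` TO EVERY ORDER** at `s i` with scale `‖s‖`. -/
theorem graded_d1Sym_sliceN (N : ℕ) (s : Fin d → ℝ) (i b : Fin d) :
    ∀ n ≤ N, ‖iteratedDeriv n (fun t : ℝ => d1Sym (Function.update s i t) b) (s i)‖ ≤ 1 * ‖s‖ ^ (1 - n) := by
  rw [d1Sym_slice_eq]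
  split_ifs with h
  · exact graded_expSub_N N (by rw [← Real.norm_eq_abs]; exact norm_le_pi_norm s i)
  · exact graded_const_N N _ zero_le_one (norm_nonneg _) (by rw [pow_one, one_mul]; exact norm_d1Sym_le_norm s b) (s i)

/-- [folklore] **THE CONJUGATE ATOM SLICE IS GRADED `(1, 1)` TO EVERY ORDER**. -/
theorem graded_conj_d1Sym_sliceN (N : ℕ) (s : Fin d → ℝ) (i b : Fin d) :
    ∀ n ≤ N, ‖iteratedDeriv n (fun t : ℝ => conj (d1Sym (Function.update s i t) b)) (s i)‖ ≤ 1 * ‖s‖ ^ (1 - n) := by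
  rw [conj_d1Sym_slice_eq]
  split_ifs with h
  · exact graded_expNegSub_N N (by rw [← Real.norm_eq_abs]; exact norm_le_pi_norm s i)
  · exact graded_const_N N _ zero_le_one (norm_nonneg _) (by rw [pow_one, one_mul, Complex.norm_conj]; exact norm_d1Sym_le_norm s b) (s i)

/-- [folklore] the curl-row slice is `ContDiff ℝ n` for every `n`. -/
theorem contDiff_curlRow_sliceN {n : WithTop ℕ∞} (s : Fin d → ℝ) (i μ ν β : Fin d) :
    ContDiff ℝ n (fun t : ℝ => curlRow (d1Sym (Function.update s i t)) μ ν β) := by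
  rw [curlRow_slice_eq]
  exact (contDiff_const.mul (contDiff_d1Sym_sliceN s i μ)).add (contDiff_const.mul (contDiff_d1Sym_sliceN s i ν))

/-- [folklore] the conjugate curl-row slice is `ContDiff ℝ n` for every `n`. -/
theorem contDiff_conj_curlRow_sliceN {n : WithTop ℕ∞} (s : Fin d → ℝ) (i μ ν γ : Fin d) :
    ContDiff ℝ n (fun t : ℝ => conj (curlRow (d1Sym (Function.update s i t)) μ ν γ)) := by
  rw [conj_curlRow_slice_eq]
  exact (contDiff_const.mul (contDiff_conj_d1Sym_sliceN s i μ)).add (contDiff_const.mul (contDiff_conj_d1Sym_sliceN s i ν))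

/-- [folklore] **THE CURL-ROW SLICE IS GRADED `(1, 2)` TO EVERY ORDER.** -/
theorem graded_curlRow_sliceN (N : ℕ) (s : Fin d → ℝ) (i μ ν β : Fin d) :
    ∀ n ≤ N, ‖iteratedDeriv n (fun t : ℝ => curlRow (d1Sym (Function.update s i t)) μ ν β) (s i)‖ ≤ 2 * ‖s‖ ^ (1 - n) := by
  rw [curlRow_slice_eq]
  have hρ : 0 ≤ ‖s‖ := norm_nonneg s
  have hU : IsOpen (Set.univ : Set ℝ) := isOpen_univ
  have hx : s i ∈ (Set.univ : Set ℝ) := Set.mem_univ _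
  have h1 := graded_mono_N (graded_const_mul_onN hU hx ((contDiff_d1Sym_sliceN (n := N) s i μ).contDiffOn) (graded_d1Sym_sliceN N s i μ)
    (if β = ν then (1 : ℂ) else 0)) (show ‖(if β = ν then (1 : ℂ) else 0)‖ * 1 ≤ 1 by rw [mul_one]; exact norm_ite_le_one _ 1 (by simp)) hρ
  have h2 := graded_mono_N (graded_const_mul_onN hU hx ((contDiff_d1Sym_sliceN (n := N) s i ν).contDiffOn) (graded_d1Sym_sliceN N s i ν)
    (if β = μ then (-1 : ℂ) else 0)) (show ‖(if β = μ then (-1 : ℂ) else 0)‖ * 1 ≤ 1 by rw [mul_one]; exact norm_ite_le_one _ (-1) (by simp)) hρ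
  have h := graded_add_onN hU hx (contDiff_const.mul (contDiff_d1Sym_sliceN (n := N) s i μ)).contDiffOn
    (contDiff_const.mul (contDiff_d1Sym_sliceN (n := N) s i ν)).contDiffOn h1 h2
  intro n hn
  calc _ ≤ (1 + 1) * ‖s‖ ^ (1 - n) := h n hn
    _ = 2 * ‖s‖ ^ (1 - n) := by norm_num

/-- [folklore] **THE CONJUGATE CURL-ROW SLICE IS GRADED `(1, 2)` TO EVERY ORDER.** -/
theorem graded_conj_curlRow_sliceN (N : ℕ) (s : Fin d → ℝ) (i μ ν γ : Fin d) :
    ∀ n ≤ N, ‖iteratedDeriv n (fun t : ℝ => conj (curlRow (d1Sym (Function.update s i t)) μ ν γ)) (s i)‖ ≤ 2 * ‖s‖ ^ (1 - n) := by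
  rw [conj_curlRow_slice_eq]
  have hρ : 0 ≤ ‖s‖ := norm_nonneg s
  have hU : IsOpen (Set.univ : Set ℝ) := isOpen_univ
  have hx : s i ∈ (Set.univ : Set ℝ) := Set.mem_univ _
  have h1 := graded_mono_N (graded_const_mul_onN hU hx ((contDiff_conj_d1Sym_sliceN (n := N) s i μ).contDiffOn) (graded_conj_d1Sym_sliceN N s i μ)
    (if γ = ν then (1 : ℂ) else 0)) (show ‖(if γ = ν then (1 : ℂ) else 0)‖ * 1 ≤ 1 by rw [mul_one]; exact norm_ite_le_one _ 1 (by simp)) hρ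
  have h2 := graded_mono_N (graded_const_mul_onN hU hx ((contDiff_conj_d1Sym_sliceN (n := N) s i ν).contDiffOn) (graded_conj_d1Sym_sliceN N s i ν)
    (if γ = μ then (-1 : ℂ) else 0)) (show ‖(if γ = μ then (-1 : ℂ) else 0)‖ * 1 ≤ 1 by rw [mul_one]; exact norm_ite_le_one _ (-1) (by simp)) hρ
  have h := graded_add_onN hU hx (contDiff_const.mul (contDiff_conj_d1Sym_sliceN (n := N) s i μ)).contDiffOn
    (contDiff_const.mul (contDiff_conj_d1Sym_sliceN (n := N) s i ν)).contDiffOn h1 h2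
  intro n hn
  calc _ ≤ (1 + 1) * ‖s‖ ^ (1 - n) := h n hn
    _ = 2 * ‖s‖ ^ (1 - n) := by norm_num

/-- [folklore] the plaquette factor slice `conj(curlRow γ)·curlRow β` is `ContDiff ℝ n` for every `n`. -/
theorem contDiff_plaq_sliceN {n : WithTop ℕ∞} (s : Fin d → ℝ) (i μ ν γ β : Fin d) :
    ContDiff ℝ n (fun t : ℝ => conj (curlRow (d1Sym (Function.update s i t)) μ ν γ) * curlRow (d1Sym (Function.update s i t)) μ ν β) :=
  (contDiff_conj_curlRow_sliceN s i μ ν γ).mul (contDiff_curlRow_sliceN s i μ ν β)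

/-- [folklore] **THE PLAQUETTE FACTOR SLICE IS GRADED `(2, 4·2^N·M²)` TO ORDER `N`** (`‖s‖ ≤ M`, `1 ≤ M`). -/
theorem graded_plaq_sliceN (N : ℕ) (s : Fin d → ℝ) (i μ ν γ β : Fin d) {M : ℝ} (hsM : ‖s‖ ≤ M) (hM : 1 ≤ M) :
    ∀ n ≤ N, ‖iteratedDeriv n (fun t : ℝ => conj (curlRow (d1Sym (Function.update s i t)) μ ν γ) * curlRow (d1Sym (Function.update s i t)) μ ν β) (s i)‖
      ≤ 4 * 2 ^ N * M ^ 2 * ‖s‖ ^ (2 - n) := by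
  have h := graded_mul_onN isOpen_univ (Set.mem_univ _) (contDiff_conj_curlRow_sliceN (n := N) s i μ ν γ).contDiffOn
    (contDiff_curlRow_sliceN (n := N) s i μ ν β).contDiffOn (by norm_num) (by norm_num)
    (graded_conj_curlRow_sliceN N s i μ ν γ) (graded_curlRow_sliceN N s i μ ν β) (norm_nonneg s) hsM hM
  intro n hn
  have := h n hn
  calc _ ≤ 2 ^ N * M ^ (1 + 1) * 2 * 2 * ‖s‖ ^ (1 + 1 - n) := this
    _ = 4 * 2 ^ N * M ^ 2 * ‖s‖ ^ (2 - n) := by rw [show (1 + 1 : ℕ) = 2 from rfl]; ring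

/-- [folklore] `2^N·2^N = 4^N`. -/
theorem two_pow_mul_two_pow (N : ℕ) : (2 : ℝ) ^ N * 2 ^ N = 4 ^ N := by
  rw [← mul_pow]; norm_num

/-! ## §2 The excess weighted Maxwell entry along a slice: ORDER 4, to order `N` -/

section Weight

variable (w : Fin d → Fin d → (Fin d → ℝ) → ℝ) (s : Fin d → ℝ) (i : Fin d) {U : Set ℝ} {N : ℕ} {cw M : ℝ}

/-- [folklore] one plaquette term of the excess entry is `ContDiffOn ℝ N · U`. -/
theorem contDiffOn_excess_termN (hwC : ∀ μ ν, ContDiffOn ℝ N (fun t : ℝ => ((w μ ν (Function.update s i t) : ℝ) : ℂ)) U) (μ ν γ β : Fin d) :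
    ContDiffOn ℝ N (fun t : ℝ => (1 / 2 : ℂ) * ((((w μ ν (Function.update s i t) : ℝ) : ℂ) - 1)
      * (conj (curlRow (d1Sym (Function.update s i t)) μ ν γ) * curlRow (d1Sym (Function.update s i t)) μ ν β))) U :=
  contDiffOn_const.mul (((hwC μ ν).sub contDiffOn_const).mul (contDiff_plaq_sliceN s i μ ν γ β).contDiffOn)

/-- [folklore] the excess entry slice is `ContDiffOn ℝ N · U`. -/
theorem contDiffOn_excess_entryN (hwC : ∀ μ ν, ContDiffOn ℝ N (fun t : ℝ => ((w μ ν (Function.update s i t) : ℝ) : ℂ)) U) (γ β : Fin d) :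
    ContDiffOn ℝ N (fun t : ℝ => maxwellMat (fun μ ν => w μ ν (Function.update s i t) - 1) (d1Sym (Function.update s i t)) γ β) U := by
  rw [excess_slice_eq]
  exact ContDiffOn.sum fun μ _ => ContDiffOn.sum fun ν _ => contDiffOn_excess_termN w s i hwC μ ν γ β

/-- [folklore] one plaquette term of the excess entry is graded `(4, 2·4^N·M⁶·cw)` to order `N` under the local hypotheses. -/
theorem graded_excess_term_onN (hU : IsOpen U) (hsi : s i ∈ U)
    (hwC : ∀ μ ν, ContDiffOn ℝ N (fun t : ℝ => ((w μ ν (Function.update s i t) : ℝ) : ℂ)) U)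
    (hcw : 0 ≤ cw) (hw : ∀ μ ν, ∀ n ≤ N, ‖iteratedDeriv n (fun t : ℝ => ((w μ ν (Function.update s i t) : ℝ) : ℂ) - 1) (s i)‖ ≤ cw * ‖s‖ ^ (2 - n))
    (hsM : ‖s‖ ≤ M) (hM : 1 ≤ M) (μ ν γ β : Fin d) :
    ∀ n ≤ N, ‖iteratedDeriv n (fun t : ℝ => (1 / 2 : ℂ) * ((((w μ ν (Function.update s i t) : ℝ) : ℂ) - 1)
      * (conj (curlRow (d1Sym (Function.update s i t)) μ ν γ) * curlRow (d1Sym (Function.update s i t)) μ ν β))) (s i)‖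
        ≤ 2 * 4 ^ N * M ^ 6 * cw * ‖s‖ ^ (4 - n) := by
  have hM0 : 0 ≤ M := zero_le_one.trans hM
  have hwC' : ContDiffOn ℝ N (fun t : ℝ => ((w μ ν (Function.update s i t) : ℝ) : ℂ) - 1) U := (hwC μ ν).sub contDiffOn_const
  have hprod := graded_mul_onN hU hsi hwC' (contDiff_plaq_sliceN (n := N) s i μ ν γ β).contDiffOn hcw (by positivity) (hw μ ν)
    (graded_plaq_sliceN N s i μ ν γ β hsM hM) (norm_nonneg s) hsM hM
  have h := graded_const_mul_onN hU hsi (hwC'.mul (contDiff_plaq_sliceN (n := N) s i μ ν γ β).contDiffOn) hprod (1 / 2 : ℂ)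
  intro n hn
  have := h n hn
  have e : ‖(1 / 2 : ℂ)‖ = 1 / 2 := by simp
  calc _ ≤ ‖(1 / 2 : ℂ)‖ * (2 ^ N * M ^ (2 + 2) * cw * (4 * 2 ^ N * M ^ 2)) * ‖s‖ ^ (2 + 2 - n) := this
    _ = 2 * (2 ^ N * 2 ^ N) * M ^ 6 * cw * ‖s‖ ^ (4 - n) := by rw [e, show (2 + 2 : ℕ) = 4 from rfl]; ring
    _ = 2 * 4 ^ N * M ^ 6 * cw * ‖s‖ ^ (4 - n) := by rw [two_pow_mul_two_pow]

/-- [our object] **THE EXCESS WEIGHTED MAXWELL ENTRY IS GRADED OF ORDER 4 TO ORDER `N` — LOCAL FORM**: `U` open, `s i ∈ U`, weight slices `ContDiffOn ℝ N · U`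
with `w − 1` graded `(2, cw)` to order `N` at `s i`, `‖s‖ ≤ M`, `1 ≤ M` ⟹ `‖∂ᵢⁿ [maxwellMat (w − 1) (p̂)]_{γβ} (s)‖ ≤ 2·4^N·d²·M⁶·cw · ‖s‖^{4−n}`, `n ≤ N`. -/
theorem graded_excess_entry_onN (hU : IsOpen U) (hsi : s i ∈ U)
    (hwC : ∀ μ ν, ContDiffOn ℝ N (fun t : ℝ => ((w μ ν (Function.update s i t) : ℝ) : ℂ)) U)
    (hcw : 0 ≤ cw) (hw : ∀ μ ν, ∀ n ≤ N, ‖iteratedDeriv n (fun t : ℝ => ((w μ ν (Function.update s i t) : ℝ) : ℂ) - 1) (s i)‖ ≤ cw * ‖s‖ ^ (2 - n))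
    (hsM : ‖s‖ ≤ M) (hM : 1 ≤ M) (γ β : Fin d) :
    ∀ n ≤ N, ‖iteratedDeriv n (fun t : ℝ => maxwellMat (fun μ ν => w μ ν (Function.update s i t) - 1) (d1Sym (Function.update s i t)) γ β) (s i)‖
      ≤ 2 * 4 ^ N * d ^ 2 * M ^ 6 * cw * ‖s‖ ^ (4 - n) := by
  rw [excess_slice_eq]
  have hinner : ∀ μ : Fin d, ∀ n ≤ N, ‖iteratedDeriv n (fun t : ℝ => ∑ ν, (1 / 2 : ℂ) * ((((w μ ν (Function.update s i t) : ℝ) : ℂ) - 1)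
      * (conj (curlRow (d1Sym (Function.update s i t)) μ ν γ) * curlRow (d1Sym (Function.update s i t)) μ ν β))) (s i)‖
        ≤ (∑ _ν : Fin d, 2 * 4 ^ N * M ^ 6 * cw) * ‖s‖ ^ (4 - n) :=
    fun μ => graded_sum_onN hU hsi (Finset.univ : Finset (Fin d)) (fun ν _ => contDiffOn_excess_termN w s i hwC μ ν γ β)
      (fun ν _ => graded_excess_term_onN w s i hU hsi hwC hcw hw hsM hM μ ν γ β)
  have h := graded_sum_onN hU hsi (Finset.univ : Finset (Fin d)) (fun μ _ => ContDiffOn.sum fun ν _ => contDiffOn_excess_termN w s i hwC μ ν γ β)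
    (fun μ _ => hinner μ)
  intro n hn
  refine (h n hn).trans (le_of_eq ?_)
  simp only [Finset.sum_const, Finset.card_univ, Fintype.card_fin, nsmul_eq_mul]
  ring

end Weight

/-! ## §3 The Feynman-completed entry: ORDER 2, to order `N` -/

section Feyn

variable (w : Fin d → Fin d → (Fin d → ℝ) → ℝ) (s : Fin d → ℝ) (i : Fin d) {U : Set ℝ} {N : ℕ} {cw M : ℝ}

/-- [folklore] the weight slice itself is graded `(0, M²cw + 1)` to order `N` (local form). -/
theorem graded_weight_slice_onN (hU : IsOpen U) (hsi : s i ∈ U)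
    (hwC : ∀ μ ν, ContDiffOn ℝ N (fun t : ℝ => ((w μ ν (Function.update s i t) : ℝ) : ℂ)) U)
    (hcw : 0 ≤ cw) (hw : ∀ μ ν, ∀ n ≤ N, ‖iteratedDeriv n (fun t : ℝ => ((w μ ν (Function.update s i t) : ℝ) : ℂ) - 1) (s i)‖ ≤ cw * ‖s‖ ^ (2 - n))
    (hsM : ‖s‖ ≤ M) (hM : 1 ≤ M) (μ ν : Fin d) :
    ∀ n ≤ N, ‖iteratedDeriv n (fun t : ℝ => ((w μ ν (Function.update s i t) : ℝ) : ℂ)) (s i)‖ ≤ (M ^ 2 * cw + 1) * ‖s‖ ^ (0 - n) := by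
  have h1 := graded_of_le_order_N (hw μ ν) hcw (Nat.zero_le 2) (norm_nonneg s) hsM hM
  have h2 := graded_const_N N (1 : ℂ) zero_le_one (norm_nonneg s) (by simp : ‖(1 : ℂ)‖ ≤ 1 * ‖s‖ ^ 0) (s i)
  have h := graded_add_onN hU hsi ((hwC μ ν).sub contDiffOn_const) contDiffOn_const h1 h2
  have e : (fun t : ℝ => (((w μ ν (Function.update s i t) : ℝ) : ℂ) - 1) + (1 : ℂ)) = fun t : ℝ => ((w μ ν (Function.update s i t) : ℝ) : ℂ) := by
    funext t; ring
  rw [e] at h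
  simpa using h

/-- [folklore] one plaquette term of the Feynman entry is `ContDiffOn ℝ N · U`. -/
theorem contDiffOn_feyn_termN (hwC : ∀ μ ν, ContDiffOn ℝ N (fun t : ℝ => ((w μ ν (Function.update s i t) : ℝ) : ℂ)) U) (μ ν γ β : Fin d) :
    ContDiffOn ℝ N (fun t : ℝ => (1 / 2 : ℂ) * ((((w μ ν (Function.update s i t) : ℝ) : ℂ))
      * (conj (curlRow (d1Sym (Function.update s i t)) μ ν γ) * curlRow (d1Sym (Function.update s i t)) μ ν β))) U :=
  contDiffOn_const.mul ((hwC μ ν).mul (contDiff_plaq_sliceN s i μ ν γ β).contDiffOn)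

/-- [folklore] the slice term `p̂_γ·conj(p̂_β)` is `ContDiff ℝ n` for every `n`. -/
theorem contDiff_slice_termN {n : WithTop ℕ∞} (γ β : Fin d) :
    ContDiff ℝ n (fun t : ℝ => d1Sym (Function.update s i t) γ * conj (d1Sym (Function.update s i t) β)) :=
  (contDiff_d1Sym_sliceN s i γ).mul (contDiff_conj_d1Sym_sliceN s i β)

/-- [folklore] the Feynman entry slice is `ContDiffOn ℝ N · U`. -/
theorem contDiffOn_feyn_entryN (hwC : ∀ μ ν, ContDiffOn ℝ N (fun t : ℝ => ((w μ ν (Function.update s i t) : ℝ) : ℂ)) U) (γ β : Fin d) :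
    ContDiffOn ℝ N (fun t : ℝ => feynMat (fun μ ν => w μ ν (Function.update s i t)) (d1Sym (Function.update s i t)) γ β) U := by
  rw [feyn_slice_eq]
  exact (ContDiffOn.sum fun μ _ => ContDiffOn.sum fun ν _ => contDiffOn_feyn_termN w s i hwC μ ν γ β).add
    (contDiff_slice_termN (n := N) s i γ β).contDiffOn

/-- [folklore] one plaquette term of the Feynman entry is graded `(2, 2·4^N·M⁴·(M²cw + 1))` to order `N` (local form). -/
theorem graded_feyn_term_onN (hU : IsOpen U) (hsi : s i ∈ U)
    (hwC : ∀ μ ν, ContDiffOn ℝ N (fun t : ℝ => ((w μ ν (Function.update s i t) : ℝ) : ℂ)) U)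
    (hcw : 0 ≤ cw) (hw : ∀ μ ν, ∀ n ≤ N, ‖iteratedDeriv n (fun t : ℝ => ((w μ ν (Function.update s i t) : ℝ) : ℂ) - 1) (s i)‖ ≤ cw * ‖s‖ ^ (2 - n))
    (hsM : ‖s‖ ≤ M) (hM : 1 ≤ M) (μ ν γ β : Fin d) :
    ∀ n ≤ N, ‖iteratedDeriv n (fun t : ℝ => (1 / 2 : ℂ) * ((((w μ ν (Function.update s i t) : ℝ) : ℂ))
      * (conj (curlRow (d1Sym (Function.update s i t)) μ ν γ) * curlRow (d1Sym (Function.update s i t)) μ ν β))) (s i)‖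
        ≤ 2 * 4 ^ N * M ^ 4 * (M ^ 2 * cw + 1) * ‖s‖ ^ (2 - n) := by
  have hM0 : 0 ≤ M := zero_le_one.trans hM
  have hprod := graded_mul_onN hU hsi (hwC μ ν) (contDiff_plaq_sliceN (n := N) s i μ ν γ β).contDiffOn (by positivity) (by positivity)
    (graded_weight_slice_onN w s i hU hsi hwC hcw hw hsM hM μ ν) (graded_plaq_sliceN N s i μ ν γ β hsM hM) (norm_nonneg s) hsM hM
  have h := graded_const_mul_onN hU hsi ((hwC μ ν).mul (contDiff_plaq_sliceN (n := N) s i μ ν γ β).contDiffOn) hprod (1 / 2 : ℂ)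
  intro n hn
  have := h n hn
  have e : ‖(1 / 2 : ℂ)‖ = 1 / 2 := by simp
  calc _ ≤ ‖(1 / 2 : ℂ)‖ * (2 ^ N * M ^ (0 + 2) * (M ^ 2 * cw + 1) * (4 * 2 ^ N * M ^ 2)) * ‖s‖ ^ (0 + 2 - n) := this
    _ = 2 * (2 ^ N * 2 ^ N) * M ^ 4 * (M ^ 2 * cw + 1) * ‖s‖ ^ (2 - n) := by rw [e, show (0 + 2 : ℕ) = 2 from rfl]; ring
    _ = 2 * 4 ^ N * M ^ 4 * (M ^ 2 * cw + 1) * ‖s‖ ^ (2 - n) := by rw [two_pow_mul_two_pow]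

/-- [folklore] the slice term `p̂_γ·conj(p̂_β)` is graded `(2, 2^N·M²)` to order `N`. -/
theorem graded_slice_termN (N : ℕ) (hsM : ‖s‖ ≤ M) (hM : 1 ≤ M) (γ β : Fin d) :
    ∀ n ≤ N, ‖iteratedDeriv n (fun t : ℝ => d1Sym (Function.update s i t) γ * conj (d1Sym (Function.update s i t) β)) (s i)‖
      ≤ 2 ^ N * M ^ 2 * ‖s‖ ^ (2 - n) := by
  have h := graded_mul_onN isOpen_univ (Set.mem_univ _) (contDiff_d1Sym_sliceN (n := N) s i γ).contDiffOn
    (contDiff_conj_d1Sym_sliceN (n := N) s i β).contDiffOn zero_le_one zero_le_one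
    (graded_d1Sym_sliceN N s i γ) (graded_conj_d1Sym_sliceN N s i β) (norm_nonneg s) hsM hM
  intro n hn
  have := h n hn
  calc _ ≤ 2 ^ N * M ^ (1 + 1) * 1 * 1 * ‖s‖ ^ (1 + 1 - n) := this
    _ = 2 ^ N * M ^ 2 * ‖s‖ ^ (2 - n) := by rw [show (1 + 1 : ℕ) = 2 from rfl]; ring

/-- [our object] **THE FEYNMAN-COMPLETED WEIGHTED MAXWELL ENTRY IS GRADED OF ORDER 2 TO ORDER `N` — LOCAL FORM**: under the local weight hypotheses,
`‖∂ᵢⁿ [feynMat w (p̂)]_{γβ} (s)‖ ≤ (2·4^N·d²·M⁴·(M²cw + 1) + 2^N·M²) · ‖s‖^{2−n}` for `n ≤ N`. -/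
theorem graded_feyn_entry_onN (hU : IsOpen U) (hsi : s i ∈ U)
    (hwC : ∀ μ ν, ContDiffOn ℝ N (fun t : ℝ => ((w μ ν (Function.update s i t) : ℝ) : ℂ)) U)
    (hcw : 0 ≤ cw) (hw : ∀ μ ν, ∀ n ≤ N, ‖iteratedDeriv n (fun t : ℝ => ((w μ ν (Function.update s i t) : ℝ) : ℂ) - 1) (s i)‖ ≤ cw * ‖s‖ ^ (2 - n))
    (hsM : ‖s‖ ≤ M) (hM : 1 ≤ M) (γ β : Fin d) :
    ∀ n ≤ N, ‖iteratedDeriv n (fun t : ℝ => feynMat (fun μ ν => w μ ν (Function.update s i t)) (d1Sym (Function.update s i t)) γ β) (s i)‖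
      ≤ (2 * 4 ^ N * d ^ 2 * M ^ 4 * (M ^ 2 * cw + 1) + 2 ^ N * M ^ 2) * ‖s‖ ^ (2 - n) := by
  rw [feyn_slice_eq]
  have hinner : ∀ μ : Fin d, ∀ n ≤ N, ‖iteratedDeriv n (fun t : ℝ => ∑ ν, (1 / 2 : ℂ) * ((((w μ ν (Function.update s i t) : ℝ) : ℂ))
      * (conj (curlRow (d1Sym (Function.update s i t)) μ ν γ) * curlRow (d1Sym (Function.update s i t)) μ ν β))) (s i)‖
        ≤ (∑ _ν : Fin d, 2 * 4 ^ N * M ^ 4 * (M ^ 2 * cw + 1)) * ‖s‖ ^ (2 - n) :=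
    fun μ => graded_sum_onN hU hsi (Finset.univ : Finset (Fin d)) (fun ν _ => contDiffOn_feyn_termN w s i hwC μ ν γ β)
      (fun ν _ => graded_feyn_term_onN w s i hU hsi hwC hcw hw hsM hM μ ν γ β)
  have hS := graded_sum_onN hU hsi (Finset.univ : Finset (Fin d)) (fun μ _ => ContDiffOn.sum fun ν _ => contDiffOn_feyn_termN w s i hwC μ ν γ β)
    (fun μ _ => hinner μ)
  have h := graded_add_onN hU hsi (ContDiffOn.sum fun μ _ => ContDiffOn.sum fun ν _ => contDiffOn_feyn_termN w s i hwC μ ν γ β)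
    (contDiff_slice_termN (n := N) s i γ β).contDiffOn hS (graded_slice_termN s i N hsM hM γ β)
  intro n hn
  refine (h n hn).trans (le_of_eq ?_)
  simp only [Finset.sum_const, Finset.card_univ, Fintype.card_fin, nsmul_eq_mul]
  ring

end Feyn

/-! ## §4 The chain along a slice from local regularity, to order `N` -/

/-- [folklore] **THE CHAIN, LOCAL FORM, TO ORDER `N`**: if the slice `t ↦ G (update s i t)` is `ContDiffOn ℝ N` on an open `U` then for `j < N` and every `t ∈ U`
the `j`-th slice derivative has the `(j+1)`-st as its derivative at `t`. -/
theorem hasDerivAt_iteratedDeriv_slice_onN {G : (Fin d → ℝ) → ℂ} {s : Fin d → ℝ} {i : Fin d} {U : Set ℝ} (hU : IsOpen U) {N : ℕ}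
    (hG : ContDiffOn ℝ N (fun t : ℝ => G (Function.update s i t)) U) {j : ℕ} (hj : j < N) {t : ℝ} (ht : t ∈ U) :
    HasDerivAt (iteratedDeriv j (fun u : ℝ => G (Function.update s i u)))
      (iteratedDeriv (j + 1) (fun u : ℝ => G (Function.update s i u)) t) t :=
  hasDerivAt_iteratedDeriv_onN hU hG hj ht

/-- [folklore] BRIDGE: the order-3 constants — `2·4³ = 128` and `2³ = 8`. -/
example : (2 * 4 ^ 3 : ℝ) = 128 ∧ (2 ^ 3 : ℝ) = 8 := by norm_num

end Summit.QuantumFields.BalabanUV.Beta.FP.MaxwellSymbolDerivN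

end
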